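import Literature.NumberTheory.Automorphic.LevelOrbitSplitting
import HarnessLib

/-!
# Level orbits X: kernel representatives — a split level is finitely generated over a finer split
# level by elements of `e⁻¹(1 × K)`

For a splitting `e : G ≃ G₁ × G₂` and finite-part levels `K, K' ≤ G₂` with `K ∩ K'` of finite index in
`K` (e.g. `K` compact, `K'` open), the split level `M = e⁻¹(G₁ × K)` is `M'·S` for the finer split level
`M' = e⁻¹(G₁ × K')` and a FINITE set `S ⊆ e⁻¹(1 × K) ⊆ ker (splitProj)` of representatives
(`exists_finset_splitLevel_eq_mul`, `…_of_isCompact`, and the two-level form `…_inf` for `K' = K ∩ K_P`).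
This is exactly the generation hypothesis `hgen` (with `hS : S ⊆ ker π`) of the sub-piece decomposition
(`LevelOrbitSubpiecesMeasure.exists_finset_subpieces`) and of the meeting lemmas (`LevelOrbitMeeting`,
`LevelOrbitMeetingProjection`): adelically, `G(F_∞)K = G(F_∞)(K ∩ K_P) · ({1} × reps (K/(K ∩ K_P)))`.

* `symm_one_mem_splitLevel`, `splitProj_symm_one`: the kernel elements `e⁻¹(1, t)`, `t ∈ K`.
* `exists_finset_splitLevel_eq_mul` (finite index), `exists_finset_splitLevel_eq_mul_of_isCompact`
  (`K` compact, `K'` open, `G₂` a topological group), `exists_finset_splitLevel_inf_eq_mul_of_isCompact`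
  (`K' = K ⊓ K_P`).

Everything is proved (theorems only); no named facts.
-/

set_option autoImplicit false

open Set Function

namespace Literature.NumberTheory.Automorphic.LevelOrbit

/-! ## § 1. The kernel elements `e⁻¹(1, t)` -/

section Algebra

variable {G G₁ G₂ : Type*} [Group G] [Group G₁] [Group G₂] (e : G ≃* G₁ × G₂) (K : Subgroup G₂)

/-- `e⁻¹(1, t) ∈ e⁻¹(G₁ × K)` for `t ∈ K` ("`(1, k) ∈ G(F_∞)K`"). [folklore] -/
theorem symm_one_mem_splitLevel {t : G₂} (ht : t ∈ K) : e.symm (1, t) ∈ splitLevel e K := by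
  rw [mem_splitLevel_iff, MulEquiv.apply_symm_apply]
  exact ht

/-- `e⁻¹(1, t)` lies in `ker (splitProj)`: its `G₁`-component is `1`. [folklore] -/
theorem splitProj_symm_one {t : G₂} (ht : t ∈ K) :
    splitProj e K ⟨e.symm (1, t), symm_one_mem_splitLevel e K ht⟩ = 1 := by
  rw [splitProj_apply, MulEquiv.apply_symm_apply]

/-! ## § 2. Finite generation over a finer split level -/

/-- **A split level is finitely generated over a finer split level by kernel representatives**:
if `K ∩ K'` has finite index in `K` (no inclusion `K' ≤ K` needed), there is a finite `S ⊆ e⁻¹(1 × K)` (so `splitProj k = 1` on `S`) with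
`e⁻¹(G₁ × K) = e⁻¹(G₁ × K') · S`, i.e. every `m` is `m' * k` with `m' ∈ e⁻¹(G₁ × K')`, `k ∈ S`
(take `S = e⁻¹(1 × T⁻¹)` for a set `T` of left-coset representatives of `K'` in `K`). [folklore] -/
theorem exists_finset_splitLevel_eq_mul (K' : Subgroup G₂) [Finite (K ⧸ K'.subgroupOf K)] :
    ∃ S : Finset (splitLevel e K), (∀ k ∈ S, splitProj e K k = 1) ∧
      ∀ m : splitLevel e K, ∃ m' : splitLevel e K', ∃ k ∈ S, (m : G) = m' * k := by
  classical
  haveI : Fintype (K ⧸ K'.subgroupOf K) := Fintype.ofFinite _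
  refine ⟨Finset.univ.image fun q : K ⧸ K'.subgroupOf K =>
      ⟨e.symm (1, ((q.out⁻¹ : K) : G₂)), symm_one_mem_splitLevel e K (q.out⁻¹).2⟩, ?_, fun m => ?_⟩
  · intro k hk
    obtain ⟨q, -, rfl⟩ := Finset.mem_image.mp hk
    exact splitProj_symm_one e K (q.out⁻¹).2
  · -- the finite-part component `κ ∈ K` of `m`, and its left coset representative
    set κ : K := ⟨(e (m : G)).2, (mem_splitLevel_iff e K _).mp m.2⟩ with hκdef
    obtain ⟨t, ht⟩ := QuotientGroup.mk_out_eq_mul (K'.subgroupOf K) κ⁻¹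
    -- `out (mk κ⁻¹) = κ⁻¹ * t` with `t ∈ K'`; so `κ = t * (out)⁻¹`
    have htK' : ((t : K) : G₂) ∈ K' := Subgroup.mem_subgroupOf.mp t.2
    refine ⟨⟨e.symm ((e (m : G)).1, ((t : K) : G₂)), by
        rw [mem_splitLevel_iff, MulEquiv.apply_symm_apply]; exact htK'⟩,
      ⟨e.symm (1, ((((QuotientGroup.mk (κ⁻¹ : K) : K ⧸ K'.subgroupOf K).out)⁻¹ : K) : G₂)),
        symm_one_mem_splitLevel e K (((QuotientGroup.mk (κ⁻¹ : K) : K ⧸ K'.subgroupOf K).out)⁻¹).2⟩,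
      Finset.mem_image_of_mem _ (Finset.mem_univ _), ?_⟩
    apply e.injective
    rw [map_mul, MulEquiv.apply_symm_apply, MulEquiv.apply_symm_apply, Prod.mk_mul_mk, mul_one, ht,
      Subgroup.coe_inv, Subgroup.coe_mul, Subgroup.coe_inv, mul_inv_rev, inv_inv,
      mul_inv_cancel_left]

/-- The generation statement with the representatives read in `G₂`: every `m ∈ e⁻¹(G₁ × K)` is
`m' * e⁻¹(1, s)` with `m' ∈ e⁻¹(G₁ × K')` and `s` in a finite subset of `K`. [folklore] -/
theorem exists_finset_splitLevel_eq_mul' (K' : Subgroup G₂) [Finite (K ⧸ K'.subgroupOf K)] :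
    ∃ T : Finset K, ∀ m : splitLevel e K, ∃ m' : splitLevel e K', ∃ s ∈ T,
      (m : G) = m' * e.symm (1, (s : G₂)) := by
  classical
  haveI : Fintype (K ⧸ K'.subgroupOf K) := Fintype.ofFinite _
  refine ⟨Finset.univ.image fun q : K ⧸ K'.subgroupOf K => q.out⁻¹, fun m => ?_⟩
  set κ : K := ⟨(e (m : G)).2, (mem_splitLevel_iff e K _).mp m.2⟩ with hκdef
  obtain ⟨t, ht⟩ := QuotientGroup.mk_out_eq_mul (K'.subgroupOf K) κ⁻¹
  have htK' : ((t : K) : G₂) ∈ K' := Subgroup.mem_subgroupOf.mp t.2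
  refine ⟨⟨e.symm ((e (m : G)).1, ((t : K) : G₂)), by
      rw [mem_splitLevel_iff, MulEquiv.apply_symm_apply]; exact htK'⟩,
    ((QuotientGroup.mk (κ⁻¹ : K) : K ⧸ K'.subgroupOf K).out)⁻¹,
    Finset.mem_image_of_mem _ (Finset.mem_univ _), ?_⟩
  apply e.injective
  rw [map_mul, MulEquiv.apply_symm_apply, MulEquiv.apply_symm_apply, Prod.mk_mul_mk, mul_one, ht,
    Subgroup.coe_inv, Subgroup.coe_mul, Subgroup.coe_inv, mul_inv_rev, inv_inv, mul_inv_cancel_left]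

end Algebra

/-! ## § 3. Compact `K`, open `K'` -/

section Topology

variable {G G₁ G₂ : Type*} [Group G] [Group G₁] [Group G₂] [TopologicalSpace G₂] [IsTopologicalGroup G₂]
  (e : G ≃* G₁ × G₂) (K : Subgroup G₂)

/-- An open subgroup has finite index in a compact one: `K'` open, `K` compact ⇒ `K / (K ∩ K')` finite
(Mathlib `Subgroup.quotient_finite_of_isOpen` on the compact group `K`). [folklore] -/
theorem finite_quotient_subgroupOf_of_isCompact {K' : Subgroup G₂} (hKc : IsCompact (K : Set G₂))
    (hK'o : IsOpen (K' : Set G₂)) : Finite (K ⧸ K'.subgroupOf K) := by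
  haveI : CompactSpace K := isCompact_iff_compactSpace.mp hKc
  exact Subgroup.quotient_finite_of_isOpen _ (hK'o.preimage continuous_subtype_val)

/-- **Finite generation, compact-open form**: `K` compact, `K'` open ⇒ `e⁻¹(G₁ × K) = e⁻¹(G₁ × K')·S`
for a finite `S ⊆ e⁻¹(1 × K)`. [folklore] -/
theorem exists_finset_splitLevel_eq_mul_of_isCompact (K' : Subgroup G₂) (hKc : IsCompact (K : Set G₂))
    (hK'o : IsOpen (K' : Set G₂)) :
    ∃ S : Finset (splitLevel e K), (∀ k ∈ S, splitProj e K k = 1) ∧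
      ∀ m : splitLevel e K, ∃ m' : splitLevel e K', ∃ k ∈ S, (m : G) = m' * k := by
  haveI := finite_quotient_subgroupOf_of_isCompact K hKc hK'o
  exact exists_finset_splitLevel_eq_mul e K K'

/-- **Finite generation, two-level form** (`K' = K ∩ K_P`): `K` compact, `K_P` open ⇒
`e⁻¹(G₁ × K) = e⁻¹(G₁ × (K ∩ K_P))·S` for a finite `S ⊆ e⁻¹(1 × K)` — the hypotheses `hS`, `hgen` of
`exists_finset_subpieces` / the meeting lemmas for `M = e⁻¹(G₁ × K)`, `M' = e⁻¹(G₁ × (K ∩ K_P))`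
("`G(F_∞)K = G(F_∞)(K ∩ K_P) · ({1} × reps)`"). [folklore] -/
theorem exists_finset_splitLevel_inf_eq_mul_of_isCompact (K_P : Subgroup G₂) (hKc : IsCompact (K : Set G₂))
    (hKo : IsOpen (K : Set G₂)) (hKPo : IsOpen (K_P : Set G₂)) :
    ∃ S : Finset (splitLevel e K), (∀ k ∈ S, splitProj e K k = 1) ∧
      ∀ m : splitLevel e K, ∃ m' : splitLevel e (K ⊓ K_P), ∃ k ∈ S, (m : G) = m' * k :=
  exists_finset_splitLevel_eq_mul_of_isCompact e K (K ⊓ K_P) hKc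
    (by rw [Subgroup.coe_inf]; exact hKo.inter hKPo)

end Topology

end Literature.NumberTheory.Automorphic.LevelOrbit
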